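import Mathlib.Analysis.Complex.ExponentialBounds
import Summits.Ventures.WeilGRH.DualTrigLatticeCertMod13Class2One
import Summits.Ventures.WeilGRH.DualTrigLatticeCertMod13Class5One
import Summits.Ventures.WeilGRH.DualTrigLatticeCertMod13Class6One
import HarnessLib

/-!
# Every odd Dirichlet character mod 13: Weil positivity on `[−1, 1]`

Cell `rh-explicit`, WEIL TRACK — GRH ARM, route B (weil-grh-3, gen18).  Assembly (no kernel work) of the format-D-K v3 / v3.2 EXACT-WINDOW
(`t = 1`, `latsOKw 1 1`) instance files of the odd key classes of CONDUCTOR 13 — the smallest conductor whose odd complex classes the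
multi-lattice dual certificates reach at `t = 1` (files `DualTrigLatticeCertMod13Class2One`, `DualTrigLatticeCertMod13Class5One`, `DualTrigLatticeCertMod13Class6One`).
Since `2` generates `(ℤ/13)ˣ` (order 12), `χ(2)^12 = 1`; for an odd character `χ(2)^6 = χ(−1) = −1`, so `χ(2) = e(k/12)` with `k` odd —
exactly the 6 certified characters (3 census classes and their conjugates).
Headline: `weilPositivityOnChar_mod13_one_of_odd` — for EVERY Dirichlet character `χ` mod 13 with `χ(−1) = −1` and every smooth `g`
supported in `[−1, 1]`, `Re W_χ(g ⋆ g̃) ≥ 0`.  Context: the arm's uniform `t = 1` floors cover every odd character of modulus `q ≥ 31`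
(`weilPositivityOnChar_one_of_odd_ge_31`); 13 is in the odd remainder list of `UniformConductorFloorCoprimeRemainder`.  Honest scope: a
theorem for these characters and this window only.  No named facts, no `sorry`; axioms standard.
-/

namespace Summit.Ventures.WeilGRH

open Literature.NumberTheory.LFunctions

/-- **Every ODD Dirichlet character mod 13 satisfies Weil positivity on `[−1, 1]`.**  `2` generates `(ℤ/13)ˣ`, `χ(2)^12 = 1`
and `χ(2)^6 = χ(−1) = −1`, so `χ(2) = e(k/12)` with `k` odd: one kernel-certified census class (or its conjugate) per case. [folklore] -/
theorem weilPositivityOnChar_mod13_one_of_odd (χ : DirichletCharacter ℂ 13) (hχ : χ.Odd) :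
    WeilPositivityOnChar χ 1 := by
  have h12 : χ (2 : ZMod 13) ^ 12 = 1 := by
    rw [← map_pow, show (2 : ZMod 13) ^ 12 = 1 by decide, map_one]
  have h6 : χ (2 : ZMod 13) ^ 6 = -1 := by
    rw [← map_pow, show (2 : ZMod 13) ^ 6 = -1 by decide]; exact hχ
  have hprim : IsPrimitiveRoot (Complex.exp (2 * Real.pi * Complex.I / 12)) 12 :=
    Complex.isPrimitiveRoot_exp 12 (by norm_num)
  obtain ⟨k, hk, hζ⟩ := hprim.eq_pow_of_pow_eq_one h12
  have eζ : Complex.exp (2 * Real.pi * Complex.I / 12) ^ k = Complex.exp (2 * Real.pi * Complex.I * ((k : ℂ) / 12)) := by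
    rw [← Complex.exp_nat_mul]; congr 1; ring
  rw [eζ] at hζ
  have hodd : ¬ (∃ j : ℕ, k = 2 * j) := by
    rintro ⟨j, rfl⟩
    have h1 : χ (2 : ZMod 13) ^ 6 = 1 := by
      rw [← hζ, ← Complex.exp_nat_mul, Complex.exp_eq_one_iff]
      exact ⟨(j : ℤ), by push_cast; ring⟩
    rw [h1] at h6
    norm_num at h6
  interval_cases k
  · exact absurd ⟨0, rfl⟩ hodd
  · refine weilPositivityOnChar_mod13_class2_one χ ?_
    rw [← hζ, Complex.exp_eq_exp_iff_exists_int]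
    exact ⟨0, by push_cast; ring⟩
  · exact absurd ⟨1, rfl⟩ hodd
  · refine weilPositivityOnChar_mod13_class5_one_conj χ ?_
    rw [← hζ, Complex.exp_eq_exp_iff_exists_int]
    exact ⟨0, by push_cast; ring⟩
  · exact absurd ⟨2, rfl⟩ hodd
  · refine weilPositivityOnChar_mod13_class6_one χ ?_
    rw [← hζ, Complex.exp_eq_exp_iff_exists_int]
    exact ⟨0, by push_cast; ring⟩
  · exact absurd ⟨3, rfl⟩ hodd
  · refine weilPositivityOnChar_mod13_class6_one_conj χ ?_
    rw [← hζ, Complex.exp_eq_exp_iff_exists_int]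
    exact ⟨1, by push_cast; ring⟩
  · exact absurd ⟨4, rfl⟩ hodd
  · refine weilPositivityOnChar_mod13_class5_one χ ?_
    rw [← hζ, Complex.exp_eq_exp_iff_exists_int]
    exact ⟨1, by push_cast; ring⟩
  · exact absurd ⟨5, rfl⟩ hodd
  · refine weilPositivityOnChar_mod13_class2_one_conj χ ?_
    rw [← hζ, Complex.exp_eq_exp_iff_exists_int]
    exact ⟨1, by push_cast; ring⟩

/-- **Every odd Dirichlet character mod 13: Weil positivity on every window `[−t, t]`, `t ≤ 1`.** [folklore] -/
theorem weilPositivityOnChar_mod13_of_le_one_of_odd (χ : DirichletCharacter ℂ 13) (hχ : χ.Odd) {t : ℝ} (ht : t ≤ 1) :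
    WeilPositivityOnChar χ t :=
  (weilPositivityOnChar_mod13_one_of_odd χ hχ).mono ht

end Summit.Ventures.WeilGRH

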